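import Summits.QuantumFields.YangMills.Theorems.AllWindowsColdBoxBoxHighLineWilsonPlaquetteQuarticForm
import Summits.QuantumFields.YangMills.Theorems.AllWindowsColdBoxBoxHighLineQuarticVertexColdBox
import Summits.QuantumFields.YangMills.Theorems.AllWindowsColdBoxBoxHighLineLinCurvSqCentredForm
import Summits.QuantumFields.YangMills.Theorems.AllWindowsColdBoxBoxHighLinePlaquettePairSums
import Summits.QuantumFields.YangMills.Theorems.AllWindowsColdBoxBoxHighLineEdgeChartHyper

/-!
# K3′ exact row E1 (Wilson quartic vertex), E₀-EXACT CORE: the connected Gaussian three-point function of two quadratic plaquette observables against the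
# polynomial quartic Wilson vertex `β·Σ_z Σ_{ijkl} Q_{ijkl}(v^z_i·v^z_j)(v^z_k·v^z_l)` is `≤ C·B·(1+log H)⁵/β³`, UNIFORMLY in the two plaquettes
# (ASSEMBLY-U5 §8, E1 chain (β); blocker B2 of U5-BLOCKERS — the reason lift L2 exists)

Width seat `ym-line-sfw-p2-w3` (g42), cell ym-idea-1 (planner ym-idea-2 g18 RULING 2026-08-30T01:12:48Z / g19 Q8 01:44:58Z: `−quarticWilson = −β·Σ_p Q_p` EXACT `+ −β·Σ_p Rem₆,p`
sup×L²).  Over ✓`WickPairCubic.abs_gaussAvg_centredLandauForms_mul_four_connected_le` (w3 g41, per quartic MONOMIAL with legs near a site `x`) and this seat's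
✓`EdgeChartGaussian.quarticPairSum_plaqVar_expansion` (a quartic pair form = `Σ_k cA_k·∏ a_{leg}`, `Σ|cA| ≤ 2304B`, legs on the plaquette edges):

* `polyCert_prod_four`, `polyCert_quarticPairSum` — measurability/integrability certificates;
* ★ `abs_gaussCum3_centredLinCurvSq_quarticPairSum_plaq_le` — ONE vertex plaquette `(z,μ,ν)`, GENERIC tensor `|Q| ≤ B`:
  `|E₀[L̃_pL̃_q·w_z] − E₀[L̃_pL̃_q]·E₀[w_z]| ≤ 2304B·β⁻⁴·C·(1+log H)⁴·[(1+d(z,p))⁻⁶(1+d(z,q))⁻⁶ + (1+‖p−q‖₁)⁻⁴(1+d(z,p))⁻³(1+d(z,q))⁻³]`, `L̃_r = linCurvSq_r − E₀ linCurvSq_r`,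
  `w_z = Σ_{ijkl} Q_{ijkl}(v_i·v_j)(v_k·v_l)`, `v = plaqVar H z μ ν a` (bridge ✓`Cum3Triangle.linCurvSq_sub_gaussAvg_eq_centredForm`, locality ✓`plaqEdge_fst_sub_le`);
* ★★ `abs_gaussCum3_centredLinCurvSq_quarticPairVertex_le` — summed over the plaquettes touching the box with the factor `β`, UNIFORM in `p, q`:
  `|E₀[L̃_pL̃_q·W] − E₀[L̃_pL̃_q]·E₀[W]| ≤ C·B·(1+log H)⁵·β⁻¹^3`, `W = β·Σ_{z touching} w_z` (✓`PlaqSums.plaquetteCentreSums` (i),(ii) after `(1+d)⁻⁶ ≤ (1+d)⁻⁴`,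
  `(1+d)⁻³ ≤ (1+d)⁻²`, `(1+‖p−q‖₁)⁻⁴ ≤ 1`).  RELATIVE to the main term (`×β²H⁸`, floor `40e/H⁸`): `H⁸(1+log H)⁵/β → 0` iff `8θ < 1` — for every `θ < 1/10`,
  in place of blocker B2's Cauchy–Schwarz `H¹²/β`.
The instance of record is `Q` := the quartic tensor of ✓`WilsonTaylor.exists_quarticTensor_quarticWilson` (`B = 1/2`); the `μ_{D′}` transfer (fcl-p3's
✓`GaussRestrict.abs_tiltCum3_muSet_zero_sub_gaussAvg_centred_le`) is the next file.

Tree only; no definitions; standard axioms.  HONEST LABEL: helper-grade brick of the RECORDED lift L2 of the NEXT rung U5 (⟨stmt-QuantumFields-24336⟩, UNSTAFFED); ⟨24004⟩ ⟨24336⟩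
and this seat's crux ⟨stmt-QuantumFields-22884⟩ remain OPEN; route AllWindowsColdBox is DRAFT; no crux, rung or summit is proved; **the Yang–Mills mass gap is NOT proved by
this file; no summit is proved by a line.**
-/

set_option autoImplicit false

noncomputable section

open MeasureTheory Matrix Finset
open Literature.Probability.LatticeModels (Site)
open Literature.MathematicalPhysics.QuantumLattice (ZdPlaquette plaquettesTouching)
open Literature.MathematicalPhysics.QuantumFieldTheory (Plaq)
open Literature.MathematicalPhysics.QuantumFieldTheory.AxialGauge (boxEdges)

namespace Summit.QuantumFields.YangMills.Theorems.AllWindowsColdBoxBoxHighLine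

namespace EdgeChartGaussian

open LaplaceSandwich (flatten)

variable {H : ℕ}

/-! ## §1 Certificates -/

/-- A product of four coordinate legs is a certified polynomial of degree `≤ 4`. -/
theorem polyCert_prod_four (l : Fin 4 → LandauFree H × Fin 3) :
    ∃ P : MvPolynomial (LandauFree H × Fin 3) ℝ, P.totalDegree ≤ 4 ∧ ∀ a : LandauFree H → E3,
      (∏ s : Fin 4, a (l s).1 (l s).2) = MvPolynomial.eval (flatten (LandauFree H) a) P := by
  have h := polyCert_mul (polyCert_mul (polyCert_mul (polyCert_coord (l 0).1 (l 0).2 le_rfl) (polyCert_coord (l 1).1 (l 1).2 le_rfl))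
    (polyCert_coord (l 2).1 (l 2).2 le_rfl)) (polyCert_coord (l 3).1 (l 3).2 le_rfl)
  obtain ⟨P, hP, hP'⟩ := h
  exact ⟨P, hP, fun a => by rw [Fin.prod_univ_four]; exact hP' a⟩

/-- A quartic pair form in the plaquette variables is a certified polynomial of degree `≤ 4`. -/
theorem polyCert_quarticPairSum (z : Site 4) (μ ν : Fin 4) (Q : Fin 4 → Fin 4 → Fin 4 → Fin 4 → ℝ) {B : ℝ} (hQ : ∀ i j k l, |Q i j k l| ≤ B) :
    ∃ P : MvPolynomial (LandauFree H × Fin 3) ℝ, P.totalDegree ≤ 4 ∧ ∀ a : LandauFree H → E3,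
      (∑ i : Fin 4, ∑ j : Fin 4, ∑ k : Fin 4, ∑ l : Fin 4, Q i j k l *
        ((WithLp.ofLp (plaqVar H z μ ν a i) ⬝ᵥ WithLp.ofLp (plaqVar H z μ ν a j)) *
          (WithLp.ofLp (plaqVar H z μ ν a k) ⬝ᵥ WithLp.ofLp (plaqVar H z μ ν a l)))) = MvPolynomial.eval (flatten (LandauFree H) a) P := by
  classical
  obtain ⟨K, _, cA, leg, -, -, hexp⟩ := quarticPairSum_plaqVar_expansion H z μ ν Q hQ
  obtain ⟨P, hP, hP'⟩ := polyCert_sum (Finset.univ : Finset K) (F := fun k a => cA k * ∏ s : Fin 4, a (leg k s).1 (leg k s).2)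
    fun k _ => polyCert_const_mul (cA k) (polyCert_prod_four (leg k))
  exact ⟨P, hP, fun a => by rw [hexp a]; exact hP' a⟩

/-! ## §2 One vertex plaquette -/

/-- ★ **E1 (Wilson quartic), per vertex plaquette, E₀-exact** (see the module docstring). -/
theorem abs_gaussCum3_centredLinCurvSq_quarticPairSum_plaq_le : ∃ C : ℝ, 0 ≤ C ∧ ∀ H : ℕ, 1 ≤ H → ∀ β : ℝ, 0 < β →
    ∀ B : ℝ, ∀ Q : Fin 4 → Fin 4 → Fin 4 → Fin 4 → ℝ, (∀ i j k l, |Q i j k l| ≤ B) →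
    ∀ p q : Plaq 4, ∀ z : Site 4, ∀ μ ν : Fin 4,
    |gaussAvg β H (fun a => (linCurvSq H p a - gaussAvg β H (linCurvSq H p)) * (linCurvSq H q a - gaussAvg β H (linCurvSq H q)) *
          ∑ i : Fin 4, ∑ j : Fin 4, ∑ k : Fin 4, ∑ l : Fin 4, Q i j k l *
            ((WithLp.ofLp (plaqVar H z μ ν a i) ⬝ᵥ WithLp.ofLp (plaqVar H z μ ν a j)) *
              (WithLp.ofLp (plaqVar H z μ ν a k) ⬝ᵥ WithLp.ofLp (plaqVar H z μ ν a l)))) -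
        gaussAvg β H (fun a => (linCurvSq H p a - gaussAvg β H (linCurvSq H p)) * (linCurvSq H q a - gaussAvg β H (linCurvSq H q))) *
          gaussAvg β H (fun a => ∑ i : Fin 4, ∑ j : Fin 4, ∑ k : Fin 4, ∑ l : Fin 4, Q i j k l *
            ((WithLp.ofLp (plaqVar H z μ ν a i) ⬝ᵥ WithLp.ofLp (plaqVar H z μ ν a j)) *
              (WithLp.ofLp (plaqVar H z μ ν a k) ⬝ᵥ WithLp.ofLp (plaqVar H z μ ν a l))))| ≤
      2304 * B * (β⁻¹ ^ 4 * (C * (1 + Real.log H) ^ 4 * (1 / ((1 + siteDist z p.1) ^ 6 * (1 + siteDist z q.1) ^ 6) +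
        1 / ((1 + (((∑ m : Fin 4, |p.1 m - q.1 m|) : ℤ) : ℝ)) ^ 4 * (1 + siteDist z p.1) ^ 3 * (1 + siteDist z q.1) ^ 3)))) := by
  obtain ⟨C, hC0, hmono⟩ := WickPairCubic.abs_gaussAvg_centredLandauForms_mul_four_connected_le
  refine ⟨C, hC0, fun H hH β hβ B Q hQ p q z μ ν => ?_⟩
  classical
  -- the two-point function and the Landau forms of `p`, `q`
  obtain ⟨S, hS⟩ : ∃ S : LandauFree H × Fin 3 → LandauFree H × Fin 3 → ℝ,
      S = fun i j => (2 * β)⁻¹ * if i.2 = j.2 then (hodgeQ H)⁻¹ i.1 j.1 else 0 := ⟨_, rfl⟩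
  obtain ⟨LA, hLA⟩ : ∃ L : LandauFree H × Fin 3 → LandauFree H × Fin 3 → ℝ,
      L = fun i j => if i.2 = j.2 then landauCoeff H p i.1 * landauCoeff H p j.1 else 0 := ⟨_, rfl⟩
  obtain ⟨LB, hLB⟩ : ∃ L : LandauFree H × Fin 3 → LandauFree H × Fin 3 → ℝ,
      L = fun i j => if i.2 = j.2 then landauCoeff H q i.1 * landauCoeff H q j.1 else 0 := ⟨_, rfl⟩
  have hS' : ∀ i j, S i j = (2 * β)⁻¹ * if i.2 = j.2 then (hodgeQ H)⁻¹ i.1 j.1 else 0 := fun i j => by rw [hS]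
  have hLA' : ∀ i j, LA i j = if i.2 = j.2 then landauCoeff H p i.1 * landauCoeff H p j.1 else 0 := fun i j => by rw [hLA]
  have hLB' : ∀ i j, LB i j = if i.2 = j.2 then landauCoeff H q i.1 * landauCoeff H q j.1 else 0 := fun i j => by rw [hLB]
  have hFp : ∀ a, linCurvSq H p a - gaussAvg β H (linCurvSq H p) = ∑ b, ∑ b', LA b b' * (a b.1 b.2 * a b'.1 b'.2 - S b b') :=
    Cum3Triangle.linCurvSq_sub_gaussAvg_eq_centredForm H hβ p S LA hS' hLA'
  have hFq : ∀ a, linCurvSq H q a - gaussAvg β H (linCurvSq H q) = ∑ b, ∑ b', LB b b' * (a b.1 b.2 * a b'.1 b'.2 - S b b') :=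
    Cum3Triangle.linCurvSq_sub_gaussAvg_eq_centredForm H hβ q S LB hS' hLB'
  -- the monomial expansion of the vertex
  obtain ⟨K, _, cA, leg, hsum, hedge, hexp⟩ := quarticPairSum_plaqVar_expansion H z μ ν Q hQ
  -- the size per monomial
  obtain ⟨R, hR⟩ : ∃ R : ℝ, R = β⁻¹ ^ 4 * (C * (1 + Real.log H) ^ 4 * (1 / ((1 + siteDist z p.1) ^ 6 * (1 + siteDist z q.1) ^ 6) +
      1 / ((1 + (((∑ m : Fin 4, |p.1 m - q.1 m|) : ℤ) : ℝ)) ^ 4 * (1 + siteDist z p.1) ^ 3 * (1 + siteDist z q.1) ^ 3))) := ⟨_, rfl⟩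
  have hR0 : 0 ≤ R := by
    have h1 := GhostKernel.siteDist_nonneg z p.1
    have h2 := GhostKernel.siteDist_nonneg z q.1
    have h3 : (0 : ℝ) ≤ (((∑ m : Fin 4, |p.1 m - q.1 m|) : ℤ) : ℝ) := by exact_mod_cast Finset.sum_nonneg fun m _ => abs_nonneg _
    have hL0 : 0 ≤ 1 + Real.log (H : ℝ) := by
      have : (1 : ℝ) ≤ H := by exact_mod_cast hH
      have := Real.log_nonneg this; linarith
    rw [hR]; positivity
  set F : (LandauFree H → E3) → ℝ := fun a => (linCurvSq H p a - gaussAvg β H (linCurvSq H p)) * (linCurvSq H q a - gaussAvg β H (linCurvSq H q))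
    with hFdef
  have hterm : ∀ k, |cA k * (gaussAvg β H (fun a => F a * ∏ s : Fin 4, a (leg k s).1 (leg k s).2) -
      gaussAvg β H F * gaussAvg β H (fun a => ∏ s : Fin 4, a (leg k s).1 (leg k s).2))| ≤ |cA k| * R := by
    intro k
    by_cases hk : cA k = 0
    · rw [hk]; simp only [zero_mul, abs_zero]; positivity
    rw [abs_mul]
    refine mul_le_mul_of_nonneg_left ?_ (abs_nonneg _)
    have e1 : (fun a : LandauFree H → E3 => F a * ∏ s : Fin 4, a (leg k s).1 (leg k s).2) =
        fun a => (∑ b, ∑ b', LA b b' * (a b.1 b.2 * a b'.1 b'.2 - S b b')) * (∑ b, ∑ b', LB b b' * (a b.1 b.2 * a b'.1 b'.2 - S b b')) *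
          (a (leg k 0).1 (leg k 0).2 * a (leg k 1).1 (leg k 1).2 * a (leg k 2).1 (leg k 2).2 * a (leg k 3).1 (leg k 3).2) := by
      funext a; rw [hFdef]; dsimp only; rw [hFp a, hFq a, Fin.prod_univ_four]
    have e2 : F = fun a => (∑ b, ∑ b', LA b b' * (a b.1 b.2 * a b'.1 b'.2 - S b b')) * (∑ b, ∑ b', LB b b' * (a b.1 b.2 * a b'.1 b'.2 - S b b')) := by
      funext a; rw [hFdef]; dsimp only; rw [hFp a, hFq a]
    have e3 : (fun a : LandauFree H → E3 => ∏ s : Fin 4, a (leg k s).1 (leg k s).2) =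
        fun a => a (leg k 0).1 (leg k 0).2 * a (leg k 1).1 (leg k 1).2 * a (leg k 2).1 (leg k 2).2 * a (leg k 3).1 (leg k 3).2 := by
      funext a; rw [Fin.prod_univ_four]
    rw [e1, e2, e3, hR]
    have hnear : ∀ s : Fin 4, ∀ m : Fin 4, |((((leg k s).1.1.1.1 m - z m : ℤ)) : ℝ)| ≤ 1 := by
      intro s m
      obtain ⟨i, hi⟩ := hedge k hk s
      rw [hi]; exact plaqEdge_fst_sub_le z μ ν i m
    have hv : ∀ s : Fin 4, (![leg k 0, leg k 1, leg k 2, leg k 3] : Fin 4 → LandauFree H × Fin 3) s = leg k s := fun s => by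
      fin_cases s <;> rfl
    exact hmono H hH β hβ p q S LA LB hS' hLA' hLB' z (leg k 0) (leg k 1) (leg k 2) (leg k 3) (fun s m => by rw [hv]; exact hnear s m)
  -- integrability
  have hcF : ∃ P : MvPolynomial (LandauFree H × Fin 3) ℝ, P.totalDegree ≤ 2 + 2 ∧ ∀ a, F a = MvPolynomial.eval (flatten (LandauFree H) a) P :=
    polyCert_mul (polyCert_sub (polyCert_linCurvSq H p) (polyCert_const _ 2)) (polyCert_sub (polyCert_linCurvSq H q) (polyCert_const _ 2))
  have hintF : ∀ k, Integrable fun a : LandauFree H → E3 => F a * (∏ s : Fin 4, a (leg k s).1 (leg k s).2) * gaussWeight β H a := fun k =>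
    integrable_polyCert_mul_gaussWeight H hβ (polyCert_mul hcF (polyCert_prod_four (leg k)))
  have hintM : ∀ k, Integrable fun a : LandauFree H → E3 => (∏ s : Fin 4, a (leg k s).1 (leg k s).2) * gaussWeight β H a := fun k =>
    integrable_polyCert_mul_gaussWeight H hβ (polyCert_prod_four (leg k))
  -- linearity
  have h1 : gaussAvg β H (fun a => F a * ∑ i : Fin 4, ∑ j : Fin 4, ∑ k : Fin 4, ∑ l : Fin 4, Q i j k l *
      ((WithLp.ofLp (plaqVar H z μ ν a i) ⬝ᵥ WithLp.ofLp (plaqVar H z μ ν a j)) *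
        (WithLp.ofLp (plaqVar H z μ ν a k) ⬝ᵥ WithLp.ofLp (plaqVar H z μ ν a l)))) =
      ∑ k, cA k * gaussAvg β H (fun a => F a * ∏ s : Fin 4, a (leg k s).1 (leg k s).2) := by
    have hpt : (fun a => F a * ∑ i : Fin 4, ∑ j : Fin 4, ∑ k : Fin 4, ∑ l : Fin 4, Q i j k l *
        ((WithLp.ofLp (plaqVar H z μ ν a i) ⬝ᵥ WithLp.ofLp (plaqVar H z μ ν a j)) *
          (WithLp.ofLp (plaqVar H z μ ν a k) ⬝ᵥ WithLp.ofLp (plaqVar H z μ ν a l)))) =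
        fun a => ∑ k, cA k * (F a * ∏ s : Fin 4, a (leg k s).1 (leg k s).2) := by
      funext a; rw [hexp a, Finset.mul_sum]; exact Finset.sum_congr rfl fun k _ => by ring
    rw [hpt, gaussAvg_finset_sum β H _ _ fun k _ => ((hintF k).const_mul (cA k)).congr (Filter.Eventually.of_forall fun a => by ring)]
    exact Finset.sum_congr rfl fun k _ => gaussAvg_const_mul β H _ _
  have h2 : gaussAvg β H (fun a => ∑ i : Fin 4, ∑ j : Fin 4, ∑ k : Fin 4, ∑ l : Fin 4, Q i j k l *
      ((WithLp.ofLp (plaqVar H z μ ν a i) ⬝ᵥ WithLp.ofLp (plaqVar H z μ ν a j)) *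
        (WithLp.ofLp (plaqVar H z μ ν a k) ⬝ᵥ WithLp.ofLp (plaqVar H z μ ν a l)))) =
      ∑ k, cA k * gaussAvg β H (fun a => ∏ s : Fin 4, a (leg k s).1 (leg k s).2) := by
    have hpt : (fun a => ∑ i : Fin 4, ∑ j : Fin 4, ∑ k : Fin 4, ∑ l : Fin 4, Q i j k l *
        ((WithLp.ofLp (plaqVar H z μ ν a i) ⬝ᵥ WithLp.ofLp (plaqVar H z μ ν a j)) *
          (WithLp.ofLp (plaqVar H z μ ν a k) ⬝ᵥ WithLp.ofLp (plaqVar H z μ ν a l)))) =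
        fun a => ∑ k, cA k * ∏ s : Fin 4, a (leg k s).1 (leg k s).2 := funext hexp
    rw [hpt, gaussAvg_finset_sum β H _ _ fun k _ => ((hintM k).const_mul (cA k)).congr (Filter.Eventually.of_forall fun a => by ring)]
    exact Finset.sum_congr rfl fun k _ => gaussAvg_const_mul β H _ _
  have hF' : (fun a => (linCurvSq H p a - gaussAvg β H (linCurvSq H p)) * (linCurvSq H q a - gaussAvg β H (linCurvSq H q)) *
      ∑ i : Fin 4, ∑ j : Fin 4, ∑ k : Fin 4, ∑ l : Fin 4, Q i j k l *
        ((WithLp.ofLp (plaqVar H z μ ν a i) ⬝ᵥ WithLp.ofLp (plaqVar H z μ ν a j)) *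
          (WithLp.ofLp (plaqVar H z μ ν a k) ⬝ᵥ WithLp.ofLp (plaqVar H z μ ν a l)))) =
      fun a => F a * ∑ i : Fin 4, ∑ j : Fin 4, ∑ k : Fin 4, ∑ l : Fin 4, Q i j k l *
        ((WithLp.ofLp (plaqVar H z μ ν a i) ⬝ᵥ WithLp.ofLp (plaqVar H z μ ν a j)) *
          (WithLp.ofLp (plaqVar H z μ ν a k) ⬝ᵥ WithLp.ofLp (plaqVar H z μ ν a l))) := by
    funext a; rw [hFdef]
  rw [hF', h1, h2, Finset.mul_sum, ← Finset.sum_sub_distrib]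
  have hre : ∀ k, cA k * gaussAvg β H (fun a => F a * ∏ s : Fin 4, a (leg k s).1 (leg k s).2) -
      gaussAvg β H F * (cA k * gaussAvg β H (fun a => ∏ s : Fin 4, a (leg k s).1 (leg k s).2)) =
      cA k * (gaussAvg β H (fun a => F a * ∏ s : Fin 4, a (leg k s).1 (leg k s).2) -
        gaussAvg β H F * gaussAvg β H (fun a => ∏ s : Fin 4, a (leg k s).1 (leg k s).2)) := fun k => by ring
  simp only [hre]
  have hB : 0 ≤ B := (abs_nonneg _).trans (hQ 0 0 0 0)
  calc |∑ k, cA k * (gaussAvg β H (fun a => F a * ∏ s : Fin 4, a (leg k s).1 (leg k s).2) -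
        gaussAvg β H F * gaussAvg β H (fun a => ∏ s : Fin 4, a (leg k s).1 (leg k s).2))|
      ≤ ∑ k, |cA k| * R := (Finset.abs_sum_le_sum_abs _ _).trans (Finset.sum_le_sum fun k _ => hterm k)
    _ = (∑ k, |cA k|) * R := by rw [Finset.sum_mul]
    _ ≤ 2304 * B * R := mul_le_mul_of_nonneg_right hsum hR0
    _ = _ := by rw [hR]

/-! ## §3 The vertex sum, uniform in the two plaquettes -/

/-- ★★ **E1 (Wilson quartic), E₀-exact core, UNIFORM**: for `H ≥ 1`, `β > 0`, `|Q| ≤ B` and all plaquettes `p, q`,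
`|E₀[L̃_pL̃_q·W] − E₀[L̃_pL̃_q]·E₀[W]| ≤ C·B·(1+log H)⁵·β⁻¹^3`, `W = β·Σ_{z touching} Σ_{ijkl} Q_{ijkl}(v^z_i·v^z_j)(v^z_k·v^z_l)`. -/
theorem abs_gaussCum3_centredLinCurvSq_quarticPairVertex_le : ∃ C : ℝ, 0 ≤ C ∧ ∀ H : ℕ, 1 ≤ H → ∀ β : ℝ, 0 < β →
    ∀ B : ℝ, ∀ Q : Fin 4 → Fin 4 → Fin 4 → Fin 4 → ℝ, (∀ i j k l, |Q i j k l| ≤ B) → ∀ p q : Plaq 4,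
    |gaussAvg β H (fun a => (linCurvSq H p a - gaussAvg β H (linCurvSq H p)) * (linCurvSq H q a - gaussAvg β H (linCurvSq H q)) *
          (β * ∑ z ∈ plaquettesTouching (boxEdges 4 (2 * H + 1)), ∑ i : Fin 4, ∑ j : Fin 4, ∑ k : Fin 4, ∑ l : Fin 4, Q i j k l *
            ((WithLp.ofLp (plaqVar H z.1 z.2.1.1 z.2.1.2 a i) ⬝ᵥ WithLp.ofLp (plaqVar H z.1 z.2.1.1 z.2.1.2 a j)) *
              (WithLp.ofLp (plaqVar H z.1 z.2.1.1 z.2.1.2 a k) ⬝ᵥ WithLp.ofLp (plaqVar H z.1 z.2.1.1 z.2.1.2 a l))))) -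
        gaussAvg β H (fun a => (linCurvSq H p a - gaussAvg β H (linCurvSq H p)) * (linCurvSq H q a - gaussAvg β H (linCurvSq H q))) *
          gaussAvg β H (fun a => β * ∑ z ∈ plaquettesTouching (boxEdges 4 (2 * H + 1)), ∑ i : Fin 4, ∑ j : Fin 4, ∑ k : Fin 4, ∑ l : Fin 4,
            Q i j k l * ((WithLp.ofLp (plaqVar H z.1 z.2.1.1 z.2.1.2 a i) ⬝ᵥ WithLp.ofLp (plaqVar H z.1 z.2.1.1 z.2.1.2 a j)) *
              (WithLp.ofLp (plaqVar H z.1 z.2.1.1 z.2.1.2 a k) ⬝ᵥ WithLp.ofLp (plaqVar H z.1 z.2.1.1 z.2.1.2 a l))))| ≤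
      C * B * (1 + Real.log H) ^ 5 * β⁻¹ ^ 3 := by
  obtain ⟨C, hC0, hplaq⟩ := abs_gaussCum3_centredLinCurvSq_quarticPairSum_plaq_le
  obtain ⟨CS, hCS0, hsums⟩ := PlaqSums.plaquetteCentreSums
  refine ⟨2304 * C * (2 * CS), by positivity, fun H hH β hβ B Q hQ p q => ?_⟩
  classical
  set PT := plaquettesTouching (boxEdges 4 (2 * H + 1)) with hPT
  have hH1 : (1 : ℝ) ≤ H := by exact_mod_cast hH
  have hLg0 : 0 ≤ 1 + Real.log (H : ℝ) := by have := Real.log_nonneg hH1; linarith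
  have hB : 0 ≤ B := (abs_nonneg _).trans (hQ 0 0 0 0)
  set F : (LandauFree H → E3) → ℝ := fun a => (linCurvSq H p a - gaussAvg β H (linCurvSq H p)) * (linCurvSq H q a - gaussAvg β H (linCurvSq H q))
    with hFdef
  set w : ZdPlaquette 4 → (LandauFree H → E3) → ℝ := fun z a => ∑ i : Fin 4, ∑ j : Fin 4, ∑ k : Fin 4, ∑ l : Fin 4, Q i j k l *
    ((WithLp.ofLp (plaqVar H z.1 z.2.1.1 z.2.1.2 a i) ⬝ᵥ WithLp.ofLp (plaqVar H z.1 z.2.1.1 z.2.1.2 a j)) *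
      (WithLp.ofLp (plaqVar H z.1 z.2.1.1 z.2.1.2 a k) ⬝ᵥ WithLp.ofLp (plaqVar H z.1 z.2.1.1 z.2.1.2 a l))) with hwdef
  -- per vertex plaquette, with the decays weakened to the two-centre shapes of ✓`plaquetteCentreSums`
  have hone : ∀ z : ZdPlaquette 4, |gaussAvg β H (fun a => F a * w z a) - gaussAvg β H F * gaussAvg β H (w z)| ≤
      2304 * B * (β⁻¹ ^ 4 * (C * (1 + Real.log H) ^ 4)) *
        (1 / (1 + siteDist z.1 p.1) ^ 4 + 1 / ((1 + siteDist z.1 p.1) ^ 2 * (1 + siteDist z.1 q.1) ^ 2)) := by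
    intro z
    have h := hplaq H hH β hβ B Q hQ p q z.1 z.2.1.1 z.2.1.2
    refine h.trans ?_
    have hdp := GhostKernel.siteDist_nonneg z.1 p.1
    have hdq := GhostKernel.siteDist_nonneg z.1 q.1
    have hl1 : (0 : ℝ) ≤ (((∑ m : Fin 4, |p.1 m - q.1 m|) : ℤ) : ℝ) := by exact_mod_cast Finset.sum_nonneg fun m _ => abs_nonneg _
    have hp1 : 1 ≤ 1 + siteDist z.1 p.1 := by linarith
    have hq1 : 1 ≤ 1 + siteDist z.1 q.1 := by linarith
    have w1 : 1 / ((1 + siteDist z.1 p.1) ^ 6 * (1 + siteDist z.1 q.1) ^ 6) ≤ 1 / (1 + siteDist z.1 p.1) ^ 4 := by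
      refine one_div_le_one_div_of_le (by positivity) ?_
      calc (1 + siteDist z.1 p.1) ^ 4 = (1 + siteDist z.1 p.1) ^ 4 * 1 * 1 := by ring
        _ ≤ (1 + siteDist z.1 p.1) ^ 4 * (1 + siteDist z.1 p.1) ^ 2 * (1 + siteDist z.1 q.1) ^ 6 :=
            mul_le_mul (mul_le_mul_of_nonneg_left (one_le_pow₀ hp1) (by positivity)) (one_le_pow₀ hq1) zero_le_one (by positivity)
        _ = (1 + siteDist z.1 p.1) ^ 6 * (1 + siteDist z.1 q.1) ^ 6 := by ring
    have w2 : 1 / ((1 + (((∑ m : Fin 4, |p.1 m - q.1 m|) : ℤ) : ℝ)) ^ 4 * (1 + siteDist z.1 p.1) ^ 3 * (1 + siteDist z.1 q.1) ^ 3) ≤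
        1 / ((1 + siteDist z.1 p.1) ^ 2 * (1 + siteDist z.1 q.1) ^ 2) := by
      refine one_div_le_one_div_of_le (by positivity) ?_
      calc (1 + siteDist z.1 p.1) ^ 2 * (1 + siteDist z.1 q.1) ^ 2 = 1 * ((1 + siteDist z.1 p.1) ^ 2 * 1) * ((1 + siteDist z.1 q.1) ^ 2 * 1) := by ring
        _ ≤ (1 + (((∑ m : Fin 4, |p.1 m - q.1 m|) : ℤ) : ℝ)) ^ 4 * ((1 + siteDist z.1 p.1) ^ 2 * (1 + siteDist z.1 p.1)) *
              ((1 + siteDist z.1 q.1) ^ 2 * (1 + siteDist z.1 q.1)) :=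
            mul_le_mul (mul_le_mul (one_le_pow₀ (by linarith)) (mul_le_mul_of_nonneg_left hp1 (by positivity)) (by positivity) (by positivity))
              (mul_le_mul_of_nonneg_left hq1 (by positivity)) (by positivity) (by positivity)
        _ = (1 + (((∑ m : Fin 4, |p.1 m - q.1 m|) : ℤ) : ℝ)) ^ 4 * (1 + siteDist z.1 p.1) ^ 3 * (1 + siteDist z.1 q.1) ^ 3 := by ring
    have hc : 0 ≤ 2304 * B * (β⁻¹ ^ 4 * (C * (1 + Real.log H) ^ 4)) := by positivity
    calc 2304 * B * (β⁻¹ ^ 4 * (C * (1 + Real.log H) ^ 4 * (1 / ((1 + siteDist z.1 p.1) ^ 6 * (1 + siteDist z.1 q.1) ^ 6) +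
          1 / ((1 + (((∑ m : Fin 4, |p.1 m - q.1 m|) : ℤ) : ℝ)) ^ 4 * (1 + siteDist z.1 p.1) ^ 3 * (1 + siteDist z.1 q.1) ^ 3))))
        = 2304 * B * (β⁻¹ ^ 4 * (C * (1 + Real.log H) ^ 4)) * (1 / ((1 + siteDist z.1 p.1) ^ 6 * (1 + siteDist z.1 q.1) ^ 6) +
          1 / ((1 + (((∑ m : Fin 4, |p.1 m - q.1 m|) : ℤ) : ℝ)) ^ 4 * (1 + siteDist z.1 p.1) ^ 3 * (1 + siteDist z.1 q.1) ^ 3)) := by ring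
      _ ≤ _ := mul_le_mul_of_nonneg_left (add_le_add w1 w2) hc
  -- integrability
  have hcF : ∃ P : MvPolynomial (LandauFree H × Fin 3) ℝ, P.totalDegree ≤ 2 + 2 ∧ ∀ a, F a = MvPolynomial.eval (flatten (LandauFree H) a) P :=
    polyCert_mul (polyCert_sub (polyCert_linCurvSq H p) (polyCert_const _ 2)) (polyCert_sub (polyCert_linCurvSq H q) (polyCert_const _ 2))
  have hcw : ∀ z : ZdPlaquette 4, ∃ P : MvPolynomial (LandauFree H × Fin 3) ℝ, P.totalDegree ≤ 4 ∧ ∀ a, w z a = MvPolynomial.eval (flatten (LandauFree H) a) P :=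
    fun z => polyCert_quarticPairSum (H := H) z.1 z.2.1.1 z.2.1.2 Q hQ
  have hintF : ∀ z : ZdPlaquette 4, Integrable fun a : LandauFree H → E3 => F a * w z a * gaussWeight β H a := fun z =>
    integrable_polyCert_mul_gaussWeight H hβ (polyCert_mul hcF (hcw z))
  have hintw : ∀ z : ZdPlaquette 4, Integrable fun a : LandauFree H → E3 => w z a * gaussWeight β H a := fun z =>
    integrable_polyCert_mul_gaussWeight H hβ (hcw z)
  -- linearity over the vertex sum
  have e1 : (fun a => (linCurvSq H p a - gaussAvg β H (linCurvSq H p)) * (linCurvSq H q a - gaussAvg β H (linCurvSq H q)) *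
      (β * ∑ z ∈ PT, ∑ i : Fin 4, ∑ j : Fin 4, ∑ k : Fin 4, ∑ l : Fin 4, Q i j k l *
        ((WithLp.ofLp (plaqVar H z.1 z.2.1.1 z.2.1.2 a i) ⬝ᵥ WithLp.ofLp (plaqVar H z.1 z.2.1.1 z.2.1.2 a j)) *
          (WithLp.ofLp (plaqVar H z.1 z.2.1.1 z.2.1.2 a k) ⬝ᵥ WithLp.ofLp (plaqVar H z.1 z.2.1.1 z.2.1.2 a l))))) =
      fun a => β * ∑ z ∈ PT, F a * w z a := by
    funext a; rw [hFdef, hwdef]; dsimp only; rw [Finset.mul_sum, Finset.mul_sum, Finset.mul_sum]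
    exact Finset.sum_congr rfl fun z _ => by ring
  have e2 : (fun a => β * ∑ z ∈ PT, ∑ i : Fin 4, ∑ j : Fin 4, ∑ k : Fin 4, ∑ l : Fin 4, Q i j k l *
      ((WithLp.ofLp (plaqVar H z.1 z.2.1.1 z.2.1.2 a i) ⬝ᵥ WithLp.ofLp (plaqVar H z.1 z.2.1.1 z.2.1.2 a j)) *
        (WithLp.ofLp (plaqVar H z.1 z.2.1.1 z.2.1.2 a k) ⬝ᵥ WithLp.ofLp (plaqVar H z.1 z.2.1.1 z.2.1.2 a l)))) =
      fun a => β * ∑ z ∈ PT, w z a := by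
    funext a; rw [hwdef]
  rw [e1, e2, gaussAvg_const_mul, gaussAvg_const_mul, gaussAvg_finset_sum β H PT _ fun z _ => hintF z,
    gaussAvg_finset_sum β H PT _ fun z _ => hintw z]
  have hre : β * ∑ z ∈ PT, gaussAvg β H (fun a => F a * w z a) - gaussAvg β H F * (β * ∑ z ∈ PT, gaussAvg β H (w z)) =
      β * ∑ z ∈ PT, (gaussAvg β H (fun a => F a * w z a) - gaussAvg β H F * gaussAvg β H (w z)) := by
    have step : β * ∑ z ∈ PT, gaussAvg β H (fun a => F a * w z a) - gaussAvg β H F * (β * ∑ z ∈ PT, gaussAvg β H (w z)) =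
        β * (∑ z ∈ PT, gaussAvg β H (fun a => F a * w z a) - gaussAvg β H F * ∑ z ∈ PT, gaussAvg β H (w z)) := by ring
    rw [step, Finset.mul_sum PT (fun z => gaussAvg β H (w z)) (gaussAvg β H F), ← Finset.sum_sub_distrib]
  rw [hre, abs_mul, abs_of_pos hβ]
  have hs1 := (hsums H hH p.1 p.1).1
  have hs2 := (hsums H hH p.1 q.1).2.1
  calc β * |∑ z ∈ PT, (gaussAvg β H (fun a => F a * w z a) - gaussAvg β H F * gaussAvg β H (w z))|
      ≤ β * ∑ z ∈ PT, 2304 * B * (β⁻¹ ^ 4 * (C * (1 + Real.log H) ^ 4)) *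
          (1 / (1 + siteDist z.1 p.1) ^ 4 + 1 / ((1 + siteDist z.1 p.1) ^ 2 * (1 + siteDist z.1 q.1) ^ 2)) :=
        mul_le_mul_of_nonneg_left ((Finset.abs_sum_le_sum_abs _ _).trans (Finset.sum_le_sum fun z _ => hone z)) hβ.le
    _ = β * (2304 * B * (β⁻¹ ^ 4 * (C * (1 + Real.log H) ^ 4)) *
          ((∑ z ∈ PT, 1 / (1 + siteDist z.1 p.1) ^ 4) + ∑ z ∈ PT, 1 / ((1 + siteDist z.1 p.1) ^ 2 * (1 + siteDist z.1 q.1) ^ 2))) := by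
        rw [← Finset.mul_sum, Finset.sum_add_distrib]
    _ ≤ β * (2304 * B * (β⁻¹ ^ 4 * (C * (1 + Real.log H) ^ 4)) * (CS * (1 + Real.log H) + CS * (1 + Real.log H))) :=
        mul_le_mul_of_nonneg_left (mul_le_mul_of_nonneg_left (add_le_add hs1 hs2) (by positivity)) hβ.le
    _ = (β * β⁻¹) * (2304 * C * (2 * CS) * B * (1 + Real.log H) ^ 5 * β⁻¹ ^ 3) := by ring
    _ = 2304 * C * (2 * CS) * B * (1 + Real.log H) ^ 5 * β⁻¹ ^ 3 := by rw [mul_inv_cancel₀ hβ.ne', one_mul]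

end EdgeChartGaussian

end Summit.QuantumFields.YangMills.Theorems.AllWindowsColdBoxBoxHighLine

end
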